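import Summits.QuantumFields.YangMills.Theorems.UniversalDetectorBitOfPlaneTight
import Summits.QuantumFields.YangMills.Theorems.UniversalDetectorHankelTightGlue
import Summits.QuantumFields.YangMills.Theorems.UniversalDetectorCurvatureEdgeGlue
import Summits.QuantumFields.YangMills.Theorems.UniversalDetectorHankelLongitudinal
import Summits.QuantumFields.YangMills.Theorems.UniversalDetectorHankelCeiling
import HarnessLib

/-!
# Route `UniversalDetector` — the three older engine entries imply the edge-bit crux (landed chain, assembled)

Ideator seat ym-idea-8 (generation 11, lens «dual»), answering the critic's request (idea-crit-9 VERDICT #83, P1(b)) to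
move the chain of STRONGER alternative engine entries of route `UniversalDetector` (rung R2a, `BalabanLadder.NT`) to the
Theorems side, so that the route's deciding theorem can take the weakest entry `SchemeEdgeBit` (stmt-QuantumFields-24146)
directly.  Every arrow below is a LANDED theorem, cited by name; this file only composes them:

* `SchemeCurvatureLaws → SchemeEdgeLaws` — `universalDetector_curvatureEdgeGlue` (item `CurvatureEdgeGlue`, 24088) with
  the proved `universalDetector_hankelCeiling` (24000);
* `SchemeEdgeLaws → PlaneTightScheme` — `hankelTightGlue_proof` (item `HankelTightGlue`, 24002) with the proved
  `universalDetector_hankelCeiling` / `universalDetector_hankelLongitudinal` (24000 / 24001);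
* `PlaneTightScheme → SchemeEdgeBit` — `universalDetector_bitOfPlaneTight_proof` (item `BitOfPlaneTight`, 24147).

HONEST FRAMING: implications between OPEN cruxes (24087 ⇒ 23999 ⇒ 23250 ⇒ 24146); none of them is proved here, and no
summit, rung or route is proved; the Yang–Mills mass gap is NOT proved.  [glue; folklore]
-/

set_option autoImplicit false

namespace Summit.QuantumFields.YangMills.Theorems.UniversalDetectorEntries

open Summit.QuantumFields.YangMills.Theses.UniversalDetector
open Summit.QuantumFields.YangMills.Cruxes.UniversalDetectorHankel
  (universalDetector_hankelCeiling universalDetector_hankelLongitudinal universalDetector_curvatureEdgeGlue)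
open Summit.QuantumFields.YangMills.Theorems (hankelTightGlue_proof universalDetector_bitOfPlaneTight_proof)

/-- `SchemeCurvatureLaws ⟹ SchemeEdgeLaws` (24087 ⇒ 23999): transverse curvature laws give the transverse modulus. -/
theorem schemeEdgeLaws_of_schemeCurvatureLaws (hK : SchemeCurvatureLaws) : SchemeEdgeLaws :=
  universalDetector_curvatureEdgeGlue hK universalDetector_hankelCeiling

/-- `SchemeEdgeLaws ⟹ PlaneTightScheme` (23999 ⇒ 23250): RP ceiling + longitudinal modulus + path glue. -/
theorem planeTightScheme_of_schemeEdgeLaws (hE : SchemeEdgeLaws) : PlaneTightScheme :=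
  hankelTightGlue_proof hE universalDetector_hankelCeiling universalDetector_hankelLongitudinal

/-- `PlaneTightScheme ⟹ SchemeEdgeBit` (23250 ⇒ 24146): the landed `BitOfPlaneTight`. -/
theorem schemeEdgeBit_of_planeTightScheme (hP : PlaneTightScheme) : SchemeEdgeBit :=
  universalDetector_bitOfPlaneTight_proof hP

/-- `SchemeEdgeLaws ⟹ SchemeEdgeBit` (23999 ⇒ 24146). -/
theorem schemeEdgeBit_of_schemeEdgeLaws (hE : SchemeEdgeLaws) : SchemeEdgeBit :=
  schemeEdgeBit_of_planeTightScheme (planeTightScheme_of_schemeEdgeLaws hE)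

/-- `SchemeCurvatureLaws ⟹ SchemeEdgeBit` (24087 ⇒ 24146): the whole g10/g11 chain. -/
theorem schemeEdgeBit_of_schemeCurvatureLaws (hK : SchemeCurvatureLaws) : SchemeEdgeBit :=
  schemeEdgeBit_of_schemeEdgeLaws (schemeEdgeLaws_of_schemeCurvatureLaws hK)

end Summit.QuantumFields.YangMills.Theorems.UniversalDetectorEntries
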